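import Literature.AnabelianGeometry.EtaleTheta.Discharge.Sec5Prop53Labels

/-!
# [EtTh] §5, Proposition 5.3 (iv) from the printed description of the surjection (pp. 325–326 / PDF pp. 99–100)

Mochizuki, *The étale theta function …*, Publ. RIMS **45** (2009)
[cite: MochizukiEtTh2009, Prop 5.3 (iv) p.325 (PDF p.99); proof p.326 (PDF p.100)].  Seat abc-iut-L2-d4 (merge row
W3-L2-03, third proof companion); PROOF-ONLY over this seat's `FrobenioidThetaDivisorSupport.lean` (`DivisorSupportData`,
`CspToNcspCriterion`, `CspToNcspWitnessed`) and the transport toolkit of `Discharge/Sec5Prop53Labels.lean`.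

Print (p.326 (PDF p.100)): "the preservation of (iv) follows by considering the support of primary cuspidal elements
`a ∈ Φ(A_⊚)` such that, for some `b ∈ Φ(A_⊚)^csp` which is coprime to `a` …, `b − a` is cuspidally minimal and linearly
equivalent to a primary non-cuspidal element `n ∈ Φ(A_⊚)` … the natural surjection of (iv) is obtained by mapping the
prime determined by `a` to the prime determined by `n`."  This file PROVES that implication
(`preservesCspToNcsp_of_criterion`): the configuration `(a, b, n)` is TRANSPORTED by `Ψ^Φ_{A_⊚}` (primary elements,
cuspidality, coprimality, cuspidal minimality, linear equivalence — all from `Sec5Prop53Labels`), so the printed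
description of `Prime^csp ↠ Prime^ncsp` on both sides (`CspToNcspCriterion`, with a configuration at every cusp,
`CspToNcspWitnessed`) forces `Ψ^Φ_{A_⊚}` to commute with the surjection.  Hence **Prop. 5.3 (iv) holds modulo (i) on
primes, F1-Ψ and the printed description** (the latter to be proved from the intersection theory of the special
fibre — GAP G-L2d4-2).
HONEST FRAMING: kernel-checked implications; the printed description and (i) enter as hypotheses; typed ≠ discharged;
no side taken on anything downstream. -/

namespace Literature.AnabelianGeometry.EtaleTheta

open CategoryTheory
open Literature.AlgebraicGeometry.Frobenioids

universe w v v' u u'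

namespace FrobenioidThetaDivisors

namespace DivisorSupportData

variable {C : Type u} [Category.{v} C] {D : Type u'} [Category.{v'} D] {𝔉 : ThetaFrobenioid.{w} C D}
  {𝔓 : DivisorPrimeData 𝔉} (𝔖 : DivisorSupportData 𝔓) (ψ : 𝔉.PhiAcirc ≃* 𝔉.PhiAcirc)

/-- Coprimality ("disjoint supports", p.326 (PDF p.100)) is transported by `Ψ^Φ_{A_⊚}`.
[cite: MochizukiEtTh2009, Prop 5.3 proof p.326 (PDF p.100)] -/
theorem coprime_gpMap_iff (x y : Algebra.GrothendieckGroup 𝔉.PhiAcirc) :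
    CoprimeOf 𝔖.factor (ThetaFrobenioid.gpMap ψ.toMonoidHom x) (ThetaFrobenioid.gpMap ψ.toMonoidHom y) ↔
      CoprimeOf 𝔖.factor x y := by
  change Disjoint (suppOf 𝔖.factor _) (suppOf 𝔖.factor _) ↔ Disjoint (suppOf 𝔖.factor x) (suppOf 𝔖.factor y)
  rw [𝔖.supp_gpMap, 𝔖.supp_gpMap]
  exact Set.disjoint_image_iff (Primes.congr ψ).injective

/-- Primary elements are transported: `a ∈ 𝔭 ↔ ψ a ∈ ψ𝔭`. [cite: MochizukiEtTh2009, Prop 5.3 (i) p.325 (PDF p.99)] -/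
theorem map_mem_carrier_congr {𝔭 : Primes 𝔉.PhiAcirc} {a : 𝔉.PhiAcirc} (ha : a ∈ 𝔭.carrier) :
    ψ a ∈ (Primes.congr ψ 𝔭).carrier := by
  rw [Primes.carrier_congr]
  exact ⟨a, ha, rfl⟩

end DivisorSupportData

section Surjection

variable {C : Type u} [Category.{v} C] {D : Type u'} [Category.{v'} D] {𝔉 : ThetaFrobenioid.{w} C D}
  {𝔓 : DivisorPrimeData 𝔉} (𝔖 : DivisorSupportData 𝔓) (Ψ : C ≌ C) (ι : Ψ.functor.obj 𝔉.Acirc ≅ 𝔉.Acirc)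
  (e : 𝔉.PhiAcirc ≃* 𝔉.pre.Mon (𝔉.base.obj (Ψ.functor.obj 𝔉.Acirc)))

/-- **[EtTh] Proposition 5.3 (iv), PROVED modulo (i), F1-Ψ and the printed description of the surjection**:
`Ψ^Φ_{A_⊚}` preserves "the natural surjection `Prime(Φ(A_⊚))^csp ↠ Prime(Φ(A_⊚))^ncsp`" (p.325 (PDF p.99)) — from
Prop. 5.3 (i) on primes (`hc`), the preservation of principal elements (`hP`, [FrdI] Thm. 4.9 / Cor. 4.10), and the
p.326 description on the data: a configuration `(a, b, n)` at every cusp (`CspToNcspWitnessed`) and "the natural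
surjection of (iv) is obtained by mapping the prime determined by `a` to the prime determined by `n`"
(`CspToNcspCriterion`).  [cite: MochizukiEtTh2009, Prop 5.3 (iv) p.325 (PDF p.99); proof p.326 (PDF p.100)] -/
theorem preservesCspToNcsp_of_criterion (hc : CuspPreserved 𝔓 Ψ ι e)
    (hP : ∀ x, ThetaFrobenioid.gpMap (psiPhi 𝔉 Ψ ι e).toMonoidHom x ∈ 𝔖.principal ↔ x ∈ 𝔖.principal)
    (hW : CspToNcspWitnessed 𝔖) (hCrit : CspToNcspCriterion 𝔖) : PreservesCspToNcsp 𝔓 Ψ ι e hc := by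
  intro 𝔞 h𝔞
  set ψ := psiPhi 𝔉 Ψ ι e with hψ
  obtain ⟨𝔫, h𝔫, a, b, n, ha, hn, hbc, hab, hmin, hlin⟩ := hW 𝔞 h𝔞
  -- print's description on the original side: `cspToNcsp 𝔞 = 𝔫`
  have h0 : 𝔓.cspToNcsp ⟨𝔞, h𝔞⟩ = ⟨𝔫, h𝔫⟩ := hCrit 𝔞 𝔫 h𝔞 h𝔫 a b n ha hn hbc hab hmin hlin
  -- the transported configuration `(ψ a, ψ b, ψ n)` at the cusp `ψ𝔞` over the component `ψ𝔫`
  have h𝔞' : 𝔓.IsCuspidal (Primes.congr ψ 𝔞) := (hc 𝔞).mpr h𝔞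
  have h𝔫' : ¬ 𝔓.IsCuspidal (Primes.congr ψ 𝔫) := fun h => h𝔫 ((hc 𝔫).mp h)
  have hga : Algebra.GrothendieckGroup.of (ψ a) =
      ThetaFrobenioid.gpMap ψ.toMonoidHom (Algebra.GrothendieckGroup.of a) := by
    rw [ThetaFrobenioid.gpMap_of, MulEquiv.coe_toMonoidHom]
  have hgb : Algebra.GrothendieckGroup.of (ψ b) =
      ThetaFrobenioid.gpMap ψ.toMonoidHom (Algebra.GrothendieckGroup.of b) := by
    rw [ThetaFrobenioid.gpMap_of, MulEquiv.coe_toMonoidHom]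
  have hgn : Algebra.GrothendieckGroup.of (ψ n) =
      ThetaFrobenioid.gpMap ψ.toMonoidHom (Algebra.GrothendieckGroup.of n) := by
    rw [ThetaFrobenioid.gpMap_of, MulEquiv.coe_toMonoidHom]
  have hgba : Algebra.GrothendieckGroup.of (ψ b) * (Algebra.GrothendieckGroup.of (ψ a))⁻¹ =
      ThetaFrobenioid.gpMap ψ.toMonoidHom
        (Algebra.GrothendieckGroup.of b * (Algebra.GrothendieckGroup.of a)⁻¹) := by
    rw [map_mul, map_inv, hga, hgb]
  have h1 : 𝔓.cspToNcsp ⟨Primes.congr ψ 𝔞, h𝔞'⟩ = ⟨Primes.congr ψ 𝔫, h𝔫'⟩ := by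
    refine hCrit _ _ h𝔞' h𝔫' (ψ a) (ψ b) (ψ n) (DivisorSupportData.map_mem_carrier_congr ψ ha) (DivisorSupportData.map_mem_carrier_congr ψ hn)
      ?_ ?_ ?_ ?_
    · rw [hgb]; exact (𝔖.isCuspidalGp_gpMap_iff ψ hc _).mpr hbc
    · rw [hga, hgb]; exact (𝔖.coprime_gpMap_iff ψ _ _).mpr hab
    · rw [hgba]; exact (𝔖.isCuspidallyMinimal_gpMap_iff ψ hc hP _).mpr hmin
    · rw [hgba, hgn]; exact (𝔖.linEquiv_gpMap_iff ψ hP _ _).mpr hlin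
  -- compare (proof-irrelevance on the cuspidality witnesses)
  have e1 : (𝔓.cspToNcsp ⟨Primes.congr ψ 𝔞, (hc 𝔞).mpr h𝔞⟩ : Primes 𝔉.PhiAcirc) = Primes.congr ψ 𝔫 :=
    congrArg Subtype.val h1
  have e0 : (𝔓.cspToNcsp ⟨𝔞, h𝔞⟩ : Primes 𝔉.PhiAcirc) = 𝔫 := congrArg Subtype.val h0
  rw [e1, e0]

end Surjection

end FrobenioidThetaDivisors

end Literature.AnabelianGeometry.EtaleTheta
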